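import Summits.AtomisticToContinuum.HydrodynamicLimit.Theses.TwoClocks
import Summits.AtomisticToContinuum.HydrodynamicLimit.Theorems.ImplosionDichotomyHydroLimitInBandOfHeart
import Summits.AtomisticToContinuum.HydrodynamicLimit.Theorems.ImplosionDichotomyHydroLimitInBandSplit
import Summits.AtomisticToContinuum.HydrodynamicLimit.Theorems.TwoClocksTransferEntropyClockFamilyNodesReduction
import HarnessLib

/-!
# The clock of route TwoClocks, RESTATED over what it consumes (line `Sketch`, crux stmt-AtomisticToContinuum-16625; support file)

Kernel-checked record, for the planner's restate/split of crux 16625 (`TwoClocks.TransferEntropyClock =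
KineticWindowLDUniform → ClampedTransferWindowLD → TransferActivityTails → EnergyCurrentTails → DiluteSelfConsistency →
_root_.HydrodynamicLimit`), of the statement the line's composition ACTUALLY proves once its three open stubs are granted:
the sub-problem Statement follows from the three family-uniform nodes
`HydroLimitInBandOfHeart.{KineticCurrentsWindowLDFamily, LocalClampedTransferWindowLDFamily, CoherentSuprathermalContentVanishesW}`
and the crux's two true-law tail antecedents `TransferActivityTails`, `EnergyCurrentTails` ALONE
(`hydrodynamicLimit_of_familyNodes_of_tails`): the sorry-free shared heart `HydroLimitInBandSplit.oneWindowLedger_holds`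
(crux 9133), the landed window continuity, `TransferEntropyClockFamilyNodes.lineInputs_of_familyNodes` (p135302) and
`hydroLimitInBand_of_heart`. The crux's other three antecedents are idle in that proof: `DiluteSelfConsistency` since the
D-0032 re-type put the packing guard into the Statement, `KineticWindowLDUniform` and `ClampedTransferWindowLD` because the
clock consumes only their family-uniform/local upgrades (the open stubs S3b/S4 of the line) — and `ClampedTransferWindowLD`
is moreover a CONSEQUENCE of the collisional family node (`ClampedTransferDockBridge.clampedTransferWindowLD_of_family`,
landed for the sibling crux 17615, file `OneFlightGossipEngineClampedTransferDockChildThreeRung.lean`).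
So the honest re-typing of crux 16625 is the five-antecedent implication below (provable now, this file), with the three
nodes filed as the open children; the crux as filed additionally asks to net POINTWISE thresholds of KWLDU / C′ along the
Euler reference family, which no bookkeeping does (leads -0/c1/c2/c3/c4, ideator notes r1, route review).
Lead prover-line-stmt-AtomisticToContinuum-16625-c4-0, cycle 1.
-/

namespace Summit.AtomisticToContinuum.HydrodynamicLimit.Theorems.TransferEntropyClockRestated

open Summit.AtomisticToContinuum.HydrodynamicLimit.Theses
open Summit.AtomisticToContinuum.HydrodynamicLimit.Theorems.HydroLimitInBandOfHeart
  (LocalClampedTransferWindowLDFamily CoherentSuprathermalContentVanishesW KineticCurrentsWindowLDFamily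
    hydroLimitInBand_of_heart)
open Summit.AtomisticToContinuum.HydrodynamicLimit.Theorems.TransferEntropyClockFamilyNodes
  (lineInputs_of_familyNodes hydrodynamicLimit_iff_hydroLimitInBand)

/-- **The sub-problem Statement from the three family-uniform nodes and the two true-law tail inputs alone** (the
restated clock): bundle the inputs (`lineInputs_of_familyNodes`: TA ⇒ CAT ∧ CEAT, ECT by name), run the sorry-free shared
heart `HydroLimitInBandSplit.oneWindowLedger_holds` through the landed `hydroLimitInBand_of_heart` with the landed window
continuity, and read `ImplosionDichotomy.HydroLimitInBand` as `_root_.HydrodynamicLimit` (same term since D-0032).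
[cite: Yau1991, §2] -/
theorem hydrodynamicLimit_of_familyNodes_of_tails :
    KineticCurrentsWindowLDFamily → LocalClampedTransferWindowLDFamily → CoherentSuprathermalContentVanishesW →
      TwoClocks.TransferActivityTails → TwoClocks.EnergyCurrentTails → _root_.HydrodynamicLimit :=
  fun hK hL hC h₇ h₆ =>
    hydrodynamicLimit_iff_hydroLimitInBand.mpr
      (hydroLimitInBand_of_heart HydroLimitInBandSplit.oneWindowLedger_holds
        ClampedCurrentsDockWindowContinuity.stub_windowContinuity (lineInputs_of_familyNodes hK hL hC h₇ h₆))

end Summit.AtomisticToContinuum.HydrodynamicLimit.Theorems.TransferEntropyClockRestated
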